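import Summits.AnomalousDissipation.AnomalousDissipation.Theorems.MarginalStabilityChainStrainedLayerLawClockEnstrophyClockExact
import Summits.AnomalousDissipation.AnomalousDissipation.Theorems.MarginalStabilityChainStrainedLayerLawClockCentroidLaw
import Summits.AnomalousDissipation.AnomalousDissipation.Theorems.MarginalStabilityChainStrainedLayerLawClockSecondMomentLaw
import HarnessLib

/-!
# Crux `MarginalStabilityChain.StrainedLayerLaw` (stmt-AnomalousDissipation-3007), line `FirstLemmasR2K4`
# (log-enstrophy clock + Nash roundness): the exact laws for STEADY tailed members

Support file (`--supports stmt-AnomalousDissipation-3007`; registered sub-goal `steady_exact_laws` of line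
`FirstLemmasR2K4`, lead c7, wave 3).

What it proves: along every classical solution `(u, v, p)` of the stretched two-dimensional Navier–Stokes layer
class on `(0, ∞)` (`ν, L > 0`, normalisation `γ = ΔU = 1`) with shear tails on every compact time interval which
is moreover STEADY (`u s = u t`, `v s = v t` for all `s, t > 0` — e.g. a steady stretched vortex row or the laminar
layer), the four landed exact all-time laws collapse to algebraic identities at every instant `t > 0`:
 * `Ω = 2νP` (total enstrophy = twice viscosity times total palinstrophy): `enstrophyClock_identity` on `[t/2, t]`,
   `0 = Ω(t) − Ω(t/2) = ∫_{t/2}^t (Ω − 2νP) = (t/2)(Ω(t) − 2νP(t))`;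
 * `Ω₋ = 2νP₋` (negative enstrophy / negative palinstrophy): `clock_negEnstrophy_identity stub_levelSetNull` likewise;
 * `∫∫ yω = 0` (the vorticity centroid sits on the axis of the strain): `vorticity_centroid_law` gives
   `M₁(t) = e^{−t/2}M₁(t/2) = e^{−t/2}M₁(t)` and `e^{−t/2} < 1`;
 * `∫∫ y²ω = ∫∫ uv − νL` (second moment = Reynolds stress − νL): `secondMoment_law`,
   `0 = I₂(t) − I₂(t/2) = (t/2)(−2I₂(t) + 2Π(t) − 2νL)`.
In each case the time integrand is constant on `[t/2, t]` by steadiness (`intervalIntegral.integral_congr`,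
`intervalIntegral.integral_const`). All `[folklore]` (steady balances of 2-D vorticity moments in a strain, e.g.
Majda–Bertozzi, *Vorticity and Incompressible Flow*, CUP 2002, §1.4). No facts are asserted.
-/

-- `Summit.<Summit>.<Problem>` is the tree's mandated summit-side namespace (CONVENTIONS §2); for this
-- single-conjunct summit the two coincide, so the duplicate is deliberate.
set_option linter.dupNamespace false

noncomputable section

open scoped Topology ENNReal
open Filter Set Function MeasureTheory

namespace Summit.AnomalousDissipation.AnomalousDissipation.Theorems.StrainedLayerLaw.LogEnstrophyClock

open Literature.Analysis.FluidPDE Literature.Analysis.FluidPDE.StretchedLayer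
open Summit.AnomalousDissipation.AnomalousDissipation.Theses.MarginalStabilityChain
open Summit.AnomalousDissipation.AnomalousDissipation.Theorems.StrainedLayerLaw.StrainWorkSumRule

/-- **Steady collapse of an integral balance.** If `Φ(t) − Φ(s) = ∫_s^t g` with `s < t`, `Φ s = Φ t` and `g`
constant (`= c`) on `[s, t]`, then `c = 0`. [folklore] -/
theorem steadyExactLaws_const_of_balance {s t c Φs Φt : ℝ} {g : ℝ → ℝ} (hst : s < t) (hΦ : Φs = Φt)
    (hbal : Φt - Φs = ∫ τ in s..t, g τ) (hg : ∀ τ ∈ Icc s t, g τ = c) : c = 0 := by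
  have hcongr : (∫ τ in s..t, g τ) = ∫ _τ in s..t, c :=
    intervalIntegral.integral_congr fun τ hτ => hg τ (by rwa [uIcc_of_le hst.le] at hτ)
  rw [hcongr, intervalIntegral.integral_const, smul_eq_mul, hΦ, sub_self] at hbal
  have hts : (t - s) ≠ 0 := (sub_pos.2 hst).ne'
  rcases mul_eq_zero.1 hbal.symm with h | h
  · exact absurd h hts
  · exact h

/-- **Steady collapse of an exponential law.** If `M = e^{−(t−s)} M` with `s < t` then `M = 0`. [folklore] -/
theorem steadyExactLaws_eq_zero_of_exp {s t M : ℝ} (hst : s < t) (h : M = Real.exp (-(t - s)) * M) : M = 0 := by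
  have hlt : Real.exp (-(t - s)) < 1 := Real.exp_lt_one_iff.2 (by linarith)
  have h1 : (1 - Real.exp (-(t - s))) * M = 0 := by linear_combination h
  rcases mul_eq_zero.1 h1 with h2 | h2
  · exact absurd h2 (by linarith)
  · exact h2

/-- **THE EXACT LAWS FOR STEADY TAILED MEMBERS (registered sub-goal `steady_exact_laws` of line `FirstLemmasR2K4`).**
Along every STEADY classical solution of the stretched layer class on `(0, ∞)` (`ν, L > 0`) with shear tails on
compact time intervals, at every `t > 0`: `Ω = 2νP`, `Ω₋ = 2νP₋`, `∫∫ yω = 0`, `∫∫ y²ω = ∫∫ uv − νL` — the landed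
laws `enstrophyClock_identity`, `clock_negEnstrophy_identity stub_levelSetNull`, `vorticity_centroid_law`,
`secondMoment_law` on `[t/2, t]` with a time-constant integrand. [folklore] -/
theorem steady_exact_laws : ∀ (ν L : ℝ), 0 < ν → 0 < L → ∀ (u v p : ℝ → ℝ → ℝ → ℝ), IsStretchedLayerNSSolutionOn (Ioi 0) ν 1 1 L u v p → (∀ a b : ℝ, 0 < a → a < b → ExpTails (Icc a b) u v) → (∀ s t x y : ℝ, 0 < s → 0 < t → u s x y = u t x y ∧ v s x y = v t x y) → ∀ t : ℝ, 0 < t → (∫ x in Ioc 0 L, ∫ y, vorticity (u t) (v t) x y ^ 2) = 2 * ν * (∫ x in Ioc 0 L, ∫ y, (dX (vorticity (u t) (v t)) x y ^ 2 + dY (vorticity (u t) (v t)) x y ^ 2)) ∧ negEnstrophy L (u t) (v t) = 2 * ν * negPalinstrophy L (u t) (v t) ∧ (∫ x in Ioc 0 L, ∫ y, y * vorticity (u t) (v t) x y) = 0 ∧ (∫ x in Ioc 0 L, ∫ y, y ^ 2 * vorticity (u t) (v t) x y) = (∫ x in Ioc 0 L, ∫ y, u t x y * v t x y) - ν * L :=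 by
  intro ν L hν hL u v p hsol htails hsteady t ht
  -- the window `[t/2, t]`
  set s : ℝ := t / 2 with hs_def
  have hs : 0 < s := by positivity
  have hst : s < t := by rw [hs_def]; linarith
  -- steadiness as equalities of slices
  have hu : ∀ τ : ℝ, 0 < τ → u τ = u t := fun τ hτ =>
    funext fun x => funext fun y => (hsteady τ t x y hτ ht).1
  have hv : ∀ τ : ℝ, 0 < τ → v τ = v t := fun τ hτ =>
    funext fun x => funext fun y => (hsteady τ t x y hτ ht).2
  have hpos : ∀ τ ∈ Icc s t, 0 < τ := fun τ hτ => hs.trans_le hτ.1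
  refine ⟨?_, ?_, ?_, ?_⟩
  · -- (a) `Ω = 2νP`
    have hbal := enstrophyClock_identity ν L hν hL u v p hsol htails s t hs hst.le
    have h0 := steadyExactLaws_const_of_balance (g := fun τ => (∫ x in Ioc 0 L, ∫ y, vorticity (u τ) (v τ) x y ^ 2) -
        2 * ν * ∫ x in Ioc 0 L, ∫ y, (dX (vorticity (u τ) (v τ)) x y ^ 2 + dY (vorticity (u τ) (v τ)) x y ^ 2))
      (c := (∫ x in Ioc 0 L, ∫ y, vorticity (u t) (v t) x y ^ 2) -
        2 * ν * ∫ x in Ioc 0 L, ∫ y, (dX (vorticity (u t) (v t)) x y ^ 2 + dY (vorticity (u t) (v t)) x y ^ 2))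
      hst (by rw [hu s hs, hv s hs]) hbal (fun τ hτ => by simp only [hu τ (hpos τ hτ), hv τ (hpos τ hτ)])
    linarith
  · -- (b) `Ω₋ = 2νP₋`
    have hbal := clock_negEnstrophy_identity stub_levelSetNull hν hL hsol htails hs hst.le
    have h0 := steadyExactLaws_const_of_balance
      (g := fun τ => negEnstrophy L (u τ) (v τ) - 2 * ν * negPalinstrophy L (u τ) (v τ))
      (c := negEnstrophy L (u t) (v t) - 2 * ν * negPalinstrophy L (u t) (v t))
      hst (by rw [hu s hs, hv s hs]) hbal (fun τ hτ => by simp only [hu τ (hpos τ hτ), hv τ (hpos τ hτ)])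
    linarith
  · -- (c) `∫∫ yω = 0`
    have h := vorticity_centroid_law ν L hν hL u v p hsol htails s t hs hst.le
    rw [hu s hs, hv s hs] at h
    exact steadyExactLaws_eq_zero_of_exp hst h
  · -- (d) `∫∫ y²ω = ∫∫ uv − νL`
    have hbal := secondMoment_law ν L hν hL u v p hsol htails s t hs hst.le
    have h0 := steadyExactLaws_const_of_balance
      (g := fun τ => -2 * (∫ x in Ioc 0 L, ∫ y, y ^ 2 * vorticity (u τ) (v τ) x y) +
        2 * (∫ x in Ioc 0 L, ∫ y, u τ x y * v τ x y) - 2 * ν * L)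
      (c := -2 * (∫ x in Ioc 0 L, ∫ y, y ^ 2 * vorticity (u t) (v t) x y) +
        2 * (∫ x in Ioc 0 L, ∫ y, u t x y * v t x y) - 2 * ν * L)
      hst (by rw [hu s hs, hv s hs]) hbal (fun τ hτ => by simp only [hu τ (hpos τ hτ), hv τ (hpos τ hτ)])
    linarith

end Summit.AnomalousDissipation.AnomalousDissipation.Theorems.StrainedLayerLaw.LogEnstrophyClock

end
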